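import Literature.AlgebraicGeometry.Resolution.DivisorialMonoid
import Mathlib.Algebra.BigOperators.Group.Multiset.Basic
import Mathlib.Algebra.BigOperators.Group.Finset.Basic
import Mathlib.RingTheory.Ideal.Span
import Mathlib.Algebra.Group.Submonoid.Membership
import HarnessLib

/-!
# The divisorial monoid of a product of prime elements is generated by them and the units

Topic: `Literature/AlgebraicGeometry/Resolution`. Companion to `DivisorialMonoid.lean`
(`divisorialMonoid I = {g | I ⊆ √(g)}`, the stalk of the log structure of a boundary divisor,
Kato 1994 (1.5), Thm. 11.6). For a principal ideal the monoid is `{g | ∃ n, g ∣ xⁿ}`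
(`mem_divisorialMonoid_span_singleton_iff`), and the main result of this file is the regular
(free-chart) case of **Kato 1994, Thm. 11.6** ("`M = 𝒪_X ∩ j_* 𝒪^*_U`": the divisorial log
structure of the boundary IS the one generated by the chart): in a domain, if every `x_i` is a
prime element or a unit, then

  `divisorialMonoid (∏ x_i) = A^× · ⟨x_i⟩`  (`divisorialMonoid_span_prod_eq_sup_closure`),

i.e. an element dividing a power of `∏ x_i` is a unit times a monomial in the `x_i` — Euclid's
lemma, by induction on the number of prime factors (no unique factorisation of `A` is needed).
This is what identifies, at a point of a regular scheme where the boundary components through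
it are cut out by regular parameters `x_j` (prime elements of the regular local ring), the stalk
of the divisorial log structure with the stalk monoid of the free chart `ℕʳ → 𝒪`, `e_j ↦ x_j`.

* `mem_divisorialMonoid_span_singleton_iff` — `g ∈ divisorialMonoid (x) ↔ ∃ n, g ∣ xⁿ`;
* `sup_closure_le_divisorialMonoid_span_prod` — units and monomials divide powers of `∏ x_i`;
* `mem_sup_closure_of_mul_eq_multiset_prod` — Euclid: a divisor of a product of primes-or-units
  taken from a submonoid containing the units lies in that submonoid;
* `divisorialMonoid_span_prod_eq_sup_closure` — the equality (domain, `x_i` prime or unit).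

Sources: [Kato1994] K. Kato, *Toric singularities*, Amer. J. Math. 116 (1994), (1.5), (2.2)(1)
and Thm. 11.6. [Niziol2006] W. Nizioł, J. Algebraic Geom. 15 (2006), §2.1.
-/

namespace Literature.AlgebraicGeometry.Resolution

open scoped BigOperators

variable {A : Type*} [CommRing A]

/-- For a principal ideal `(x)`, `g` lies in the divisorial monoid iff `g` divides a power of `x`.
[cite: Kato1994, (1.5)] -/
theorem mem_divisorialMonoid_span_singleton_iff {x g : A} :
    g ∈ divisorialMonoid (Ideal.span {x}) ↔ ∃ n : ℕ, g ∣ x ^ n := by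
  rw [mem_divisorialMonoid_iff, Ideal.span_singleton_le_iff_mem]
  constructor
  · rintro ⟨n, hn⟩
    exact ⟨n, Ideal.mem_span_singleton.mp hn⟩
  · rintro ⟨n, hn⟩
    exact ⟨n, Ideal.mem_span_singleton.mpr hn⟩

/-- Units and monomials in the `x_i` belong to the divisorial monoid of `(∏ x_i)`.
[cite: Kato1994, (1.5)] -/
theorem sup_closure_le_divisorialMonoid_span_prod {ι : Type*} [Fintype ι] (x : ι → A) :
    IsUnit.submonoid A ⊔ Submonoid.closure (Set.range x) ≤
      divisorialMonoid (Ideal.span {∏ i, x i}) := by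
  refine sup_le (fun g hg => isUnit_mem_divisorialMonoid _ hg) (Submonoid.closure_le.mpr ?_)
  rintro _ ⟨i, rfl⟩
  exact mem_divisorialMonoid_of_dvd_pow Ideal.le_radical (n := 1)
    (by rw [pow_one]; exact Finset.dvd_prod_of_mem x (Finset.mem_univ i))

/-- **Euclid's lemma, monoid form.** In a domain, let `M` be a submonoid containing all units.
If `h · h'` is the product of a multiset of elements of `M` each of which is prime or a unit,
then `h ∈ M`. [folklore] -/
theorem mem_of_mul_eq_multiset_prod [IsDomain A] (M : Submonoid A) (hM : IsUnit.submonoid A ≤ M)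
    (m : Multiset A) (hprime : ∀ y ∈ m, Prime y ∨ IsUnit y) (hmem : ∀ y ∈ m, y ∈ M) :
    ∀ h h' : A, h * h' = m.prod → h ∈ M := by
  induction m using Multiset.induction with
  | empty =>
    intro h h' hh
    rw [Multiset.prod_zero] at hh
    exact hM (IsUnit.of_mul_eq_one _ hh)
  | cons y m ih =>
    intro h h' hh
    rw [Multiset.prod_cons] at hh
    have hy : y ∈ y ::ₘ m := Multiset.mem_cons_self y m
    have ih' := ih (fun z hz => hprime z (Multiset.mem_cons_of_mem hz))
      (fun z hz => hmem z (Multiset.mem_cons_of_mem hz))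
    rcases hprime y hy with hp | hu
    · -- `y` prime divides `h h'`
      have hdvd : y ∣ h * h' := ⟨m.prod, hh⟩
      rcases hp.dvd_or_dvd hdvd with ⟨h₁, rfl⟩ | ⟨h₁, rfl⟩
      · -- `h = y h₁`
        have : h₁ * h' = m.prod := by
          apply mul_left_cancel₀ hp.ne_zero
          rw [← hh]; ring
        exact M.mul_mem (hmem y hy) (ih' h₁ h' this)
      · -- `h' = y h₁`
        have : h * h₁ = m.prod := by
          apply mul_left_cancel₀ hp.ne_zero
          rw [← hh]; ring
        exact ih' h h₁ this
    · -- `y` a unit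
      obtain ⟨u, rfl⟩ := hu
      have : h * (h' * ↑u⁻¹) = m.prod := by
        rw [← mul_assoc, hh, mul_comm, ← mul_assoc, Units.inv_mul, one_mul]
      exact ih' h _ this

/-- **Kato 1994, Thm. 11.6 for the free chart**: in a domain, if each `x_i` is a prime element
or a unit, the divisorial monoid of `(∏ x_i)` — the elements dividing a power of `∏ x_i` — is
the submonoid generated by the units and the `x_i`. [cite: Kato1994, Thm. 11.6] -/
theorem divisorialMonoid_span_prod_eq_sup_closure [IsDomain A] {ι : Type*} [Fintype ι]
    (x : ι → A) (hx : ∀ i, Prime (x i) ∨ IsUnit (x i)) :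
    divisorialMonoid (Ideal.span {∏ i, x i}) =
      IsUnit.submonoid A ⊔ Submonoid.closure (Set.range x) := by
  refine le_antisymm (fun g hg => ?_) (sup_closure_le_divisorialMonoid_span_prod x)
  obtain ⟨n, h', hh⟩ := mem_divisorialMonoid_span_singleton_iff.mp hg
  -- `(∏ x_i)^n` is the product of the multiset `n • (x_i)_i`
  let m : Multiset A := n • (Finset.univ.val.map x)
  have hprod : m.prod = (∏ i, x i) ^ n := by
    rw [Multiset.prod_nsmul, Finset.prod_eq_multiset_prod]
  refine mem_of_mul_eq_multiset_prod _ le_sup_left m ?_ ?_ g h' (by rw [hprod, hh])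
  · intro y hy
    obtain ⟨i, -, rfl⟩ := Multiset.mem_map.mp (Multiset.mem_of_mem_nsmul hy)
    exact hx i
  · intro y hy
    obtain ⟨i, -, rfl⟩ := Multiset.mem_map.mp (Multiset.mem_of_mem_nsmul hy)
    exact le_sup_right (b := Submonoid.closure (Set.range x))
      (Submonoid.subset_closure ⟨i, rfl⟩)

/-- In a commutative monoid, membership in `units ⊔ ⟨x_i⟩`: `g` is a unit times a monomial.
[folklore] -/
theorem mem_sup_closure_range_iff {ι : Type*} (x : ι → A) (g : A) :
    g ∈ IsUnit.submonoid A ⊔ Submonoid.closure (Set.range x) ↔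
      ∃ (u : A) (m : A), IsUnit u ∧ m ∈ Submonoid.closure (Set.range x) ∧ g = u * m := by
  rw [Submonoid.mem_sup]
  constructor
  · rintro ⟨u, hu, m, hm, rfl⟩
    exact ⟨u, m, hu, hm, rfl⟩
  · rintro ⟨u, m, hu, hm, rfl⟩
    exact ⟨u, hu, m, hm, rfl⟩

end Literature.AlgebraicGeometry.Resolution
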